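import Summits.KontsevichZagierPeriods.KontsevichZagierPeriods.Theorems.UnfoldedStokesStokesGenerationStubPolylogArgHomotopy
import Summits.KontsevichZagierPeriods.KontsevichZagierPeriods.Theorems.UnfoldedStokesStokesGenerationStubLogPairHomotopy
import Summits.KontsevichZagierPeriods.KontsevichZagierPeriods.Theorems.UnfoldedStokesStokesGenerationStubLandenLeftovers
import Summits.KontsevichZagierPeriods.KontsevichZagierPeriods.Theorems.UnfoldedStokesStokesGenerationFibrewiseClosureSum
import Summits.KontsevichZagierPeriods.KontsevichZagierPeriods.Theorems.UnfoldedStokesStokesGenerationFibrewiseRungAngSwap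

/-!
# `StokesGeneration` (stmt-KontsevichZagierPeriods-3586), line `fibrewise_stokes` — rung 20: Euler's reflection relator is
# constant modulo fibrewise-Stokes decomposability

Crux `Summit.KontsevichZagierPeriods.KontsevichZagierPeriods.Theses.UnfoldedStokes.StokesGeneration`; residual stub S2
`stub_fibrewiseStokesGeneration` (`FibStokesDecomposable`, `Theorems/UnfoldedStokesDefs.lean`). Euler's reflection formula
`Li₂(x) + Li₂(1−x) + log x·log(1−x) = π²/6` (`0 < x < 1`) has, at a real algebraic `x`, the bounded cube integrand
`R_x(s,t) = x/(1−xst) + (1−x)/(1−(1−x)st) + ℓ₁(s)ℓ₂(t)` with `ℓ₁(s) = −(1−x)/(1−(1−x)s)` (`∫ = log x`) and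
`ℓ₂(t) = −x/(1−xt)` (`∫ = log(1−x)`). This file proves that `R_{x₂} − R_{x₁}` is fibrewise-Stokes decomposable for all
algebraic `x₁, x₂ ∈ (0,1)` (`fibStokesDecomposable_eulerReflection_sub`): the Dec-class of Euler's relator does not depend on the
point. Together with rungs 18–19 (Landen, the five-term relation) this covers the classical generators of the functional
equations of the real dilogarithm modulo Dec, UP TO THE ANCHOR `π²/6`, which is deliberately not claimed: the value `π²/6`
enters S2's economy only through a period identity relating `(∫₀¹ 4/(1+x²))²` to dilogarithmic integrands (e.g.
`Li₂(−1) = −π²/12`, bounded integrand `−1/(1+st)`), and every known proof of such an identity passes through a change of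
variables whose cubification is frontier item C4 of the line — see the crux notes.

Certificate (transcendence-free, value-free): the homotopy `x(v) = x₁ + (x₂−x₁)v` in a third coordinate; the two `Li₂` terms
by the generic polylogarithm-argument homotopy (`stub_polylogArgHomotopy`), the product `log x·log(1−x)` by the log-pair
homotopy (`stub_logPairHomotopy`, three elements); since `R′(x) = 0` coefficientwise (`−log(1−x)/x + log(1−x)/x` and
`log x/(1−x) − log x/(1−x)`), the one-dimensional leftovers cancel POINTWISE up to one transposition
`((x₂−x₁)/x(v))·(ℓ₂(t,v) − ℓ₂(s,v))`, absorbed by rung 12 (`landenLeft_sub_comp_perm_of_contDiffOn`).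

References: D. Zagier, *The dilogarithm function* (2007), §I.2; M. Kontsevich, D. Zagier, *Periods* (2001), §1.1–1.2.
-/

noncomputable section

-- `Summit.KontsevichZagierPeriods.KontsevichZagierPeriods.…` is the tree's mandated layout (single-conjunct summit).
set_option linter.dupNamespace false

namespace Summit.KontsevichZagierPeriods.KontsevichZagierPeriods.Cruxes.StokesGeneration.FibrewiseStokes

open MeasureTheory Set
open Literature.NumberTheory.Transcendental
open Literature.NumberTheory.Transcendental.KZ
open Literature.ModelTheory.ExponentialFields (IsSemialgebraic)


/-- **Rung 20 (lead c6): Euler's reflection relator `Li₂(x) + Li₂(1−x) + log x·log(1−x)` is constant modulo Dec along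
algebraic `x ∈ (0,1)`.** For real algebraic `x₁, x₂ ∈ (0,1)` the difference of the cube integrands of
`R(x) = Li₂(x) + Li₂(1−x) + log x·log(1−x)` (`Li₂(w) ↦ w/(1−wst)`, `log x ↦ ∫₀¹ −(1−x)/(1−(1−x)s) ds`,
`log(1−x) ↦ ∫₀¹ −x/(1−xt) dt`; value `π²/6` at every `x`, Euler) at `x₂` and at `x₁` is fibrewise-Stokes decomposable: the
homotopy `x(v) = x₁ + (x₂−x₁)v` (`stub_polylogArgHomotopy` twice, `stub_logPairHomotopy`) leaves
`((x₂−x₁)/x(v))·(ℓ₂(t,v) − ℓ₂(s,v))`, a transposition (rung 12). The derivative identity `R′(x) = 0` has rational (indeed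
vanishing) coefficients, so no transcendence input and no value enter; the anchor `R = π²/6` itself is NOT claimed (it
needs `π` inside S2's economy — frontier). [cite: Zagier2007Dilogarithm, §I.2] -/
theorem fibStokesDecomposable_eulerReflection_sub (x₁ x₂ : ℝ) (h₁ : IsAlgebraic ℚ x₁) (h₂ : IsAlgebraic ℚ x₂)
    (h₁0 : 0 < x₁) (h₁1 : x₁ < 1) (h₂0 : 0 < x₂) (h₂1 : x₂ < 1) :
    FibStokesDecomposable 2 (fun z =>
      (x₂ / (1 - x₂ * z 0 * z 1) + (1 - x₂) / (1 - (1 - x₂) * z 0 * z 1) +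
          (-(1 - x₂) / (1 - (1 - x₂) * z 0)) * (-x₂ / (1 - x₂ * z 1))) -
        (x₁ / (1 - x₁ * z 0 * z 1) + (1 - x₁) / (1 - (1 - x₁) * z 0 * z 1) +
          (-(1 - x₁) / (1 - (1 - x₁) * z 0)) * (-x₁ / (1 - x₁ * z 1)))) := by
  classical
  have hS1 : IsSemialgebraic ℚ (Set.pi Set.univ (fun _ : Fin 1 => Set.Icc (0:ℝ) 1)) := by
    rw [← cube_eq_pi]; exact isSemialgebraic_cube
  have hS2 : IsSemialgebraic ℚ (Set.pi Set.univ (fun _ : Fin 2 => Set.Icc (0:ℝ) 1)) := by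
    rw [← cube_eq_pi]; exact isSemialgebraic_cube
  have hI : ∀ {z : Fin 1 → ℝ}, z ∈ Set.pi Set.univ (fun _ : Fin 1 => Set.Icc (0:ℝ) 1) → 0 ≤ z 0 ∧ z 0 ≤ 1 :=
    fun hz => (Set.mem_univ_pi.mp hz) 0
  have hI2 : ∀ {z : Fin 2 → ℝ}, z ∈ Set.pi Set.univ (fun _ : Fin 2 => Set.Icc (0:ℝ) 1) → ∀ i, 0 ≤ z i ∧ z i ≤ 1 :=
    fun hz i => (Set.mem_univ_pi.mp hz) i
  have calg : ∀ {t : ℝ}, IsAlgebraic ℚ t → IsSemialgebraicFunOn ℚ (Set.pi Set.univ (fun _ : Fin 1 => Set.Icc (0:ℝ) 1)) (fun _ => t) :=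
    fun ht => isSemialgebraicFunOn_const_of_isAlgebraic hS1 ht
  have calg2 : ∀ {t : ℝ}, IsAlgebraic ℚ t → IsSemialgebraicFunOn ℚ (Set.pi Set.univ (fun _ : Fin 2 => Set.Icc (0:ℝ) 1)) (fun _ => t) :=
    fun ht => isSemialgebraicFunOn_const_of_isAlgebraic hS2 ht
  have z0 : IsSemialgebraicFunOn ℚ (Set.pi Set.univ (fun _ : Fin 1 => Set.Icc (0:ℝ) 1)) (fun z => z 0) := isSemialgebraicFunOn_apply hS1 0
  have y0 : IsSemialgebraicFunOn ℚ (Set.pi Set.univ (fun _ : Fin 2 => Set.Icc (0:ℝ) 1)) (fun z => z 0) := isSemialgebraicFunOn_apply hS2 0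
  have y1 : IsSemialgebraicFunOn ℚ (Set.pi Set.univ (fun _ : Fin 2 => Set.Icc (0:ℝ) 1)) (fun z => z 1) := isSemialgebraicFunOn_apply hS2 1
  set d : ℝ := x₂ - x₁ with hd
  have hdA : IsAlgebraic ℚ d := h₂.sub h₁
  -- the path `x(v) = x₁ + d v` stays in `[min x₁ x₂, max x₁ x₂] ⊂ (0,1)`
  have hxI : ∀ v ∈ Set.Icc (0:ℝ) 1, 0 < x₁ + d * v ∧ x₁ + d * v < 1 := by
    intro v hv
    rcases le_or_gt 0 d with hd0 | hd0
    · constructor <;> nlinarith [hv.1, hv.2]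
    · constructor <;> nlinarith [hv.1, hv.2]
  -- semialgebraic / continuous path data on the `1`-cube
  have sx : IsSemialgebraicFunOn ℚ (Set.pi Set.univ (fun _ : Fin 1 => Set.Icc (0:ℝ) 1)) (fun z => x₁ + d * z 0) :=
    (calg h₁).fun_add ((calg hdA).fun_mul z0)
  have s1x : IsSemialgebraicFunOn ℚ (Set.pi Set.univ (fun _ : Fin 1 => Set.Icc (0:ℝ) 1)) (fun z => 1 - (x₁ + d * z 0)) :=
    (calg isAlgebraic_one).fun_sub sx
  -- (1) `Li₂(x(v))`
  have gA := stub_polylogArgHomotopy (fun v => x₁ + d * v) (fun _ => d) sx (calg hdA)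
    (by fun_prop) continuousOn_const
    (fun v _ => (((hasDerivAt_id' v).const_mul d).const_add x₁).congr_deriv (by ring))
    (fun v hv => (hxI v hv).2)
  -- (2) `Li₂(1 − x(v))`
  have gB := stub_polylogArgHomotopy (fun v => 1 - (x₁ + d * v)) (fun _ => -d) s1x (calg hdA).fun_neg
    (by fun_prop) continuousOn_const
    (fun v _ => ((((hasDerivAt_id' v).const_mul d).const_add x₁).const_sub 1).congr_deriv (by ring))
    (fun v hv => by linarith [(hxI v hv).1])
  -- (3) the log pair `ℓ₁(s,v) = −(1−x)/(1−(1−x)s)` (`log x`), `ℓ₂(t,v) = −x/(1−xt)` (`log(1−x)`), `x = x(v)`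
  have hden1 : ∀ z ∈ Set.pi Set.univ (fun _ : Fin 2 => Set.Icc (0:ℝ) 1), 0 < 1 - (1 - (x₁ + d * z 1)) * z 0 := by
    intro z hz
    have hx := hxI (z 1) ⟨(hI2 hz 1).1, (hI2 hz 1).2⟩
    have h0 := hI2 hz 0
    nlinarith [mul_nonneg (sub_nonneg.2 hx.2.le) h0.1, h0.2]
  have hden2 : ∀ z ∈ Set.pi Set.univ (fun _ : Fin 2 => Set.Icc (0:ℝ) 1), 0 < 1 - (x₁ + d * z 1) * z 0 := by
    intro z hz
    have hx := hxI (z 1) ⟨(hI2 hz 1).1, (hI2 hz 1).2⟩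
    have h0 := hI2 hz 0
    nlinarith [mul_nonneg hx.1.le h0.1, h0.2]
  have sx2 : IsSemialgebraicFunOn ℚ (Set.pi Set.univ (fun _ : Fin 2 => Set.Icc (0:ℝ) 1)) (fun z => x₁ + d * z 1) :=
    (calg2 h₁).fun_add ((calg2 hdA).fun_mul y1)
  have s1x2 : IsSemialgebraicFunOn ℚ (Set.pi Set.univ (fun _ : Fin 2 => Set.Icc (0:ℝ) 1)) (fun z => 1 - (x₁ + d * z 1)) :=
    (calg2 isAlgebraic_one).fun_sub sx2
  have sD1 : IsSemialgebraicFunOn ℚ (Set.pi Set.univ (fun _ : Fin 2 => Set.Icc (0:ℝ) 1)) (fun z => 1 - (1 - (x₁ + d * z 1)) * z 0) :=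
    (calg2 isAlgebraic_one).fun_sub (s1x2.fun_mul y0)
  have sD2 : IsSemialgebraicFunOn ℚ (Set.pi Set.univ (fun _ : Fin 2 => Set.Icc (0:ℝ) 1)) (fun z => 1 - (x₁ + d * z 1) * z 0) :=
    (calg2 isAlgebraic_one).fun_sub (sx2.fun_mul y0)
  have gP := stub_logPairHomotopy
    (fun s v => -(1 - (x₁ + d * v)) / (1 - (1 - (x₁ + d * v)) * s))
    (fun s v => d / (1 - (1 - (x₁ + d * v)) * s) ^ 2)
    (fun s v => d * s / (1 - (1 - (x₁ + d * v)) * s))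
    (fun t v => -(x₁ + d * v) / (1 - (x₁ + d * v) * t))
    (fun t v => -d / (1 - (x₁ + d * v) * t) ^ 2)
    (fun t v => -d * t / (1 - (x₁ + d * v) * t))
    (s1x2.fun_neg.div sD1 fun z hz => (hden1 z hz).ne')
    ((calg2 hdA).div (sD1.fun_pow 2) fun z hz => pow_ne_zero 2 (hden1 z hz).ne')
    (((calg2 hdA).fun_mul y0).div sD1 fun z hz => (hden1 z hz).ne')
    (sx2.fun_neg.div sD2 fun z hz => (hden2 z hz).ne')
    ((calg2 hdA).fun_neg.div (sD2.fun_pow 2) fun z hz => pow_ne_zero 2 (hden2 z hz).ne')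
    ((((calg2 hdA).fun_neg).fun_mul y0).div sD2 fun z hz => (hden2 z hz).ne')
    (ContinuousOn.div (by fun_prop) (by fun_prop) fun z hz => (hden1 z hz).ne')
    (ContinuousOn.div (by fun_prop) (by fun_prop) fun z hz => pow_ne_zero 2 (hden1 z hz).ne')
    (ContinuousOn.div (by fun_prop) (by fun_prop) fun z hz => (hden1 z hz).ne')
    (ContinuousOn.div (by fun_prop) (by fun_prop) fun z hz => (hden2 z hz).ne')
    (ContinuousOn.div (by fun_prop) (by fun_prop) fun z hz => pow_ne_zero 2 (hden2 z hz).ne')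
    (ContinuousOn.div (by fun_prop) (by fun_prop) fun z hz => (hden2 z hz).ne')
    (fun s hs v hv => by
      have hne : 1 - (1 - (x₁ + d * v)) * s ≠ 0 := by
        have := hden1 ![s, v] (Set.mem_univ_pi.mpr (Fin.forall_fin_two.mpr ⟨hs, Set.Ioo_subset_Icc_self hv⟩))
        simpa using this.ne'
      have hx := (((hasDerivAt_id' v).const_mul d).const_add x₁)
      have hnum := (hx.const_sub 1).fun_neg
      have hden := ((hx.const_sub 1).mul_const s).const_sub 1
      exact (hnum.div hden hne).congr_deriv (by field_simp; ring))
    (fun v hv s hs => by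
      have hne : 1 - (1 - (x₁ + d * v)) * s ≠ 0 := by
        have := hden1 ![s, v] (Set.mem_univ_pi.mpr (Fin.forall_fin_two.mpr ⟨Set.Ioo_subset_Icc_self hs, hv⟩))
        simpa using this.ne'
      have hnum := (hasDerivAt_id' s).const_mul d
      have hden := ((hasDerivAt_id' s).const_mul (1 - (x₁ + d * v))).const_sub 1
      exact (hnum.fun_div hden hne).congr_deriv (by field_simp; ring))
    (fun v _ => by simp)
    (fun t ht v hv => by
      have hne : 1 - (x₁ + d * v) * t ≠ 0 := by
        have := hden2 ![t, v] (Set.mem_univ_pi.mpr (Fin.forall_fin_two.mpr ⟨ht, Set.Ioo_subset_Icc_self hv⟩))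
        simpa using this.ne'
      have hx := (((hasDerivAt_id' v).const_mul d).const_add x₁)
      have hnum := hx.fun_neg
      have hden := (hx.mul_const t).const_sub 1
      exact (hnum.div hden hne).congr_deriv (by field_simp; ring))
    (fun v hv t ht => by
      have hne : 1 - (x₁ + d * v) * t ≠ 0 := by
        have := hden2 ![t, v] (Set.mem_univ_pi.mpr (Fin.forall_fin_two.mpr ⟨Set.Ioo_subset_Icc_self ht, hv⟩))
        simpa using this.ne'
      have hnum := (hasDerivAt_id' t).const_mul (-d)
      have hden := ((hasDerivAt_id' t).const_mul (x₁ + d * v)).const_sub 1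
      exact (hnum.fun_div hden hne).congr_deriv (by field_simp; ring))
    (fun v _ => by simp)
  -- (4) the leftover transposition `((x₂−x₁)/x(v))·(ℓ₂(z 0, v) − ℓ₂(z 1, v))`
  obtain ⟨U, hU⟩ : ∃ U : Set (Fin 3 → ℝ), U = {z | 0 < x₁ + d * z 2 ∧ 0 < 1 - (x₁ + d * z 2) * z 0 ∧
      0 < 1 - (x₁ + d * z 2) * z 1} := ⟨_, rfl⟩
  have hUo : IsOpen U := by
    have c0 : Continuous fun z : Fin 3 → ℝ => x₁ + d * z 2 := by fun_prop
    have c1 : Continuous fun z : Fin 3 → ℝ => 1 - (x₁ + d * z 2) * z 0 := by fun_prop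
    have c2 : Continuous fun z : Fin 3 → ℝ => 1 - (x₁ + d * z 2) * z 1 := by fun_prop
    rw [hU]
    exact (isOpen_lt continuous_const c0).inter ((isOpen_lt continuous_const c1).inter (isOpen_lt continuous_const c2))
  have hUsa : IsSemialgebraic ℚ U := by
    have hV : IsSemialgebraic ℚ (Set.univ : Set (Fin 3 → ℝ)) :=
      Literature.ModelTheory.ExponentialFields.isSemialgebraic_univ
    have ux' : ∀ i, IsSemialgebraicFunOn ℚ (Set.univ : Set (Fin 3 → ℝ)) (fun z => z i) := fun i =>
      isSemialgebraicFunOn_apply hV i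
    have u1 : IsSemialgebraicFunOn ℚ (Set.univ : Set (Fin 3 → ℝ)) (fun _ => x₁) := isSemialgebraicFunOn_const_of_isAlgebraic hV h₁
    have ud : IsSemialgebraicFunOn ℚ (Set.univ : Set (Fin 3 → ℝ)) (fun _ => d) := isSemialgebraicFunOn_const_of_isAlgebraic hV hdA
    have uone : IsSemialgebraicFunOn ℚ (Set.univ : Set (Fin 3 → ℝ)) (fun _ => (1:ℝ)) := by
      simpa using isSemialgebraicFunOn_const_natCast hV 1
    have ux2 := u1.fun_add (ud.fun_mul (ux' 2))
    have n0 := ux2.fun_neg.isSemialgebraic_sep_neg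
    have n1 := ((ux2.fun_mul (ux' 0)).fun_sub uone).isSemialgebraic_sep_neg
    have n2 := ((ux2.fun_mul (ux' 1)).fun_sub uone).isSemialgebraic_sep_neg
    rw [hU]
    convert n0.inter (n1.inter n2) using 1
    ext z
    simp only [Set.mem_setOf_eq, Set.mem_inter_iff, Set.mem_univ, true_and, sub_pos, sub_neg, neg_neg_iff_pos]
  have hCU : Set.pi Set.univ (fun _ : Fin 3 => Set.Icc (0:ℝ) 1) ⊆ U := by
    intro z hz
    have hm : ∀ i, z i ∈ Set.Icc (0:ℝ) 1 := fun i => (Set.mem_univ_pi.mp hz) i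
    have hx := hxI (z 2) (hm 2)
    rw [hU]
    refine ⟨hx.1, ?_, ?_⟩
    · nlinarith [mul_nonneg hx.1.le (hm 0).1, (hm 0).2]
    · nlinarith [mul_nonneg hx.1.le (hm 1).1, (hm 1).2]
  have hDx : ∀ z ∈ U, x₁ + d * z 2 ≠ 0 := fun z hz => by rw [hU] at hz; exact hz.1.ne'
  have hD0 : ∀ z ∈ U, 1 - (x₁ + d * z 2) * z 0 ≠ 0 := fun z hz => by rw [hU] at hz; exact hz.2.1.ne'
  have hD1 : ∀ z ∈ U, 1 - (x₁ + d * z 2) * z 1 ≠ 0 := fun z hz => by rw [hU] at hz; exact hz.2.2.ne'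
  have ux : ∀ i, IsSemialgebraicFunOn ℚ U (fun z => z i) := fun i => isSemialgebraicFunOn_apply hUsa i
  have uxv : IsSemialgebraicFunOn ℚ U (fun z => x₁ + d * z 2) :=
    (isSemialgebraicFunOn_const_of_isAlgebraic hUsa h₁).fun_add ((isSemialgebraicFunOn_const_of_isAlgebraic hUsa hdA).fun_mul (ux 2))
  have uone : IsSemialgebraicFunOn ℚ U (fun _ => (1:ℝ)) := by simpa using isSemialgebraicFunOn_const_natCast hUsa 1
  have hswap := landenLeft_sub_comp_perm_of_contDiffOn U hUo hCU
    (fun z => d / (x₁ + d * z 2) * (-(x₁ + d * z 2) / (1 - (x₁ + d * z 2) * z 0)))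
    (((isSemialgebraicFunOn_const_of_isAlgebraic hUsa hdA).div uxv hDx).fun_mul
      (uxv.fun_neg.div (uone.fun_sub (uxv.fun_mul (ux 0))) hD0))
    (by fun_prop (disch := assumption)) (Equiv.swap 0 1)
  -- (5) sum up and un-pad
  have hS := fibStokesDecomposable_neg 3 _
    (fibStokesDecomposable_add 3 _ _ (fibStokesDecomposable_add 3 _ _ (fibStokesDecomposable_add 3 _ _ gA gB) gP) hswap)
  have hle : 2 ≤ 3 := by norm_num
  refine fibStokesDecomposable_unpad hle _ (fibStokesDecomposable_congr_off_null 3 _ _ ∅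
    Literature.ModelTheory.ExponentialFields.isSemialgebraic_empty measure_empty (fun z hz _ => ?_) hS)
  have hzU : z ∈ U := hCU hz
  rw [hU] at hzU
  obtain ⟨dx, d0, d1⟩ := hzU
  have hm : ∀ i, z i ∈ Set.Icc (0:ℝ) 1 := fun i => (Set.mem_univ_pi.mp hz) i
  have e0 : z (Fin.castLE hle 0) = z 0 := rfl
  have e1 : z (Fin.castLE hle 1) = z 1 := rfl
  have hne20 : (2 : Fin 3) ≠ 0 := by decide
  have hne21 : (2 : Fin 3) ≠ 1 := by decide
  simp only [e0, e1, Equiv.swap_apply_left, Equiv.swap_apply_of_ne_of_ne hne20 hne21, mul_one, mul_zero, add_zero]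
  -- local proportionality identities, then `ring`
  have hx0 : x₁ + d * z 2 ≠ 0 := dx.ne'
  have hx1' : 1 - (x₁ + d * z 2) ≠ 0 := by have := (hxI (z 2) (hm 2)).2; linarith
  have i1 : d / (x₁ + d * z 2) * (-(x₁ + d * z 2) / (1 - (x₁ + d * z 2) * z 0)) = -(d / (1 - (x₁ + d * z 2) * z 0)) := by
    field_simp
  have i1' : d / (x₁ + d * z 2) * (-(x₁ + d * z 2) / (1 - (x₁ + d * z 2) * z 1)) = -(d / (1 - (x₁ + d * z 2) * z 1)) := by
    field_simp
  have i2 : -(1 - (x₁ + d * z 2)) / (1 - (1 - (x₁ + d * z 2)) * z 0) * (-d / (1 - (x₁ + d * z 2))) =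
      d / (1 - (1 - (x₁ + d * z 2)) * z 0) := by
    field_simp
  have i3 : d / (1 - (1 - (x₁ + d * z 2))) * (-(x₁ + d * z 2) / (1 - (x₁ + d * z 2) * z 1)) =
      -(d / (1 - (x₁ + d * z 2) * z 1)) := by
    have e : 1 - (1 - (x₁ + d * z 2)) = x₁ + d * z 2 := by ring
    rw [e]; field_simp
  rw [i1, i1', i2, i3, hd]
  ring


end Summit.KontsevichZagierPeriods.KontsevichZagierPeriods.Cruxes.StokesGeneration.FibrewiseStokes

end
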